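import Literature.Analysis.Complex.RiemannDomain
import Literature.Analysis.Pluripotential.WirtingerDerivatives
import Mathlib.Geometry.Manifold.PartitionOfUnity
import Mathlib.MeasureTheory.Constructions.BorelSpace.Basic
import Mathlib.MeasureTheory.Measure.Regular
import HarnessLib

/-!
# The Lebesgue measure of a Riemann domain and integration by parts

Layer `Literature/Analysis/Complex`; continues `RiemannDomain.lean` (Hörmander, *An Introduction
to Complex Analysis in Several Variables* (1973), Def. 5.4.4: spaces spread over `ℂⁿ` by a local
homeomorphism `proj`). On such a space `D` the Lebesgue measure `dλ` of `ℂ^ι` pulls back to a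
canonical Borel measure `D.vol` — «`dλ` the Lebesgue measure» of the weighted spaces
`L²(Ω, φ)` of §4.1 when `Ω` is spread over `ℂⁿ` instead of contained in it — characterised by
`D.vol A = λ(proj(A))` for every Borel set `A` on which `proj` is injective (`vol_eq_volume_image`):

* `vol` — the measure (glued from the pull-backs of `λ` along a countable family of flat charts
  over a disjoint Borel decomposition); `vol_eq_volume_image`, `map_symm_volume_restrict`
  (`(λ|e.target) ∘ e⁻¹ = vol|e.source` for every local inverse `e` of `proj`), the change of
  variables `setIntegral_source_eq` / `integral_eq_of_tsupport_subset`
  (`∫_D f d vol = ∫_{e.target} f ∘ e⁻¹ dλ` for `f` supported in `e.source`);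
* `instIsFiniteMeasureOnCompacts` (hence locally finite, σ-finite);
* **integration by parts without boundary**: `integral_fderivF_apply_eq_zero`,
  `integral_del_eq_zero`, `integral_dbar_eq_zero` — `∫_D ∂_v w d vol = ∫_D ∂̄_v w d vol = 0` for a
  compactly supported `C^∞` function `w` (smooth partition of unity subordinate to the flat charts,
  transport of each piece to `ℂ^ι`, and `∫_{ℂ^ι} D_v F dλ = 0` there, the tree's
  `Literature.Analysis.Pluripotential.integral_dirDeriv_eq_zero`). This is the identity
  «`∫ w₁ (∂w₂/∂z̄_k)‾ e^{-φ} dλ = -∫ δ_k w₁ w̄₂ e^{-φ} dλ, w₁, w₂ ∈ C₀^∞(Ω)`» of Hörmander p. 83 in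
  its primitive form `∫ ∂(·) = 0`.

Everything is proved; definitions: `RiemannDomain.vol` (and the measurable-space instances);
no named facts.

## References

* L. Hörmander, *An Introduction to Complex Analysis in Several Variables*, 2nd ed. (1973),
  Def. 5.4.4, §4.1 (the spaces `L²(Ω, φ)` with respect to `dλ`), §4.2 p. 83 (adjointness of
  `∂/∂z̄_k` and `-δ_k` on `C₀^∞`). [HormanderSCV1973]

#harness_tags complex_analysis.several_variables, complex_analysis.l2_estimates, complex_geometry.riemann_existence
-/

noncomputable section

open scoped Manifold ContDiff Topology ComplexConjugate ENNReal
open Set Filter Function Complex OpenPartialHomeomorph MeasureTheory MeasureTheory.Measure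
open Literature.Geometry.Manifold

namespace Literature.Analysis.Complex

namespace RiemannDomain

universe u

variable {ι : Type} [Fintype ι] (D : RiemannDomain.{u} ι)

/-! ### Borel structure -/

/-- The Borel σ-algebra of a Riemann domain. [folklore] -/
instance instMeasurableSpace : MeasurableSpace D := borel D

/-- A Riemann domain carries its Borel σ-algebra. [folklore] -/
instance instBorelSpace : BorelSpace D := ⟨rfl⟩

/-- `proj` is measurable. [folklore] -/
theorem measurable_proj : Measurable D.proj := D.isLocalHomeomorph.continuous.measurable

/-! ### Local inverses of `proj` as measurable embeddings -/

section Embedding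

variable {D}

/-- A local inverse `e` of `proj` restricted to its source, as a map `e.source → ℂ^ι`, is a
measurable embedding (a homeomorphism onto the open set `e.target`). [folklore] -/
theorem measurableEmbedding_restrict (e : OpenPartialHomeomorph D (ι → ℂ)) :
    MeasurableEmbedding (fun y : e.source ↦ e y) := by
  have h1 : MeasurableEmbedding (Subtype.val : e.target → (ι → ℂ)) :=
    MeasurableEmbedding.subtype_coe e.open_target.measurableSet
  have h2 : MeasurableEmbedding (e.toHomeomorphSourceTarget : e.source → e.target) :=
    e.toHomeomorphSourceTarget.measurableEmbedding
  have := h1.comp h2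
  exact this

/-- Images under `proj` of Borel subsets of the source of a local inverse are Borel. [folklore] -/
theorem measurableSet_image {e : OpenPartialHomeomorph D (ι → ℂ)} (he : ⇑e = D.proj) {A : Set D}
    (hA : MeasurableSet A) (hAe : A ⊆ e.source) : MeasurableSet (D.proj '' A) := by
  have h := (measurableEmbedding_restrict e).measurableSet_image' (measurableSet_preimage
    (measurable_subtype_coe) hA : MeasurableSet (Subtype.val ⁻¹' A : Set e.source))
  convert h using 1
  ext z
  simp only [mem_image, mem_preimage, Subtype.exists, exists_and_right, ← he]
  constructor
  · rintro ⟨y, hy, rfl⟩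
    exact ⟨y, ⟨hAe hy, hy⟩, rfl⟩
  · rintro ⟨y, ⟨hy, hyA⟩, rfl⟩
    exact ⟨y, hyA, rfl⟩

end Embedding

/-! ### The measure -/

section Measure

/-- A countable family of flat charts covering `D`, indexed by `ℕ` (empty `D`: anything).
[folklore] -/
theorem exists_iUnion_chart_source_eq_univ [Nonempty D] :
    ∃ c : ℕ → D, (⋃ k, (D.chart (c k)).source) = univ := by
  obtain ⟨S, hSc, hS⟩ := TopologicalSpace.countable_cover_nhds
    (fun x : D ↦ (D.chart x).open_source.mem_nhds (D.mem_chart_source x))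
  rcases S.eq_empty_or_nonempty with rfl | hne
  · simp only [mem_empty_iff_false, iUnion_of_empty, iUnion_empty] at hS
    exact ⟨fun _ ↦ Classical.arbitrary D, by
      rw [eq_comm, ← hS, eq_comm, eq_empty_iff_forall_notMem]
      intro x hx
      have : x ∈ (univ : Set D) := mem_univ x
      rw [← hS] at this
      exact this⟩
  · obtain ⟨c, hc⟩ := hSc.exists_eq_range hne
    refine ⟨c, ?_⟩
    rw [← hS, hc, biUnion_range]

variable {D} in
/-- The centres of a countable covering family of flat charts (a choice). [folklore] -/
private def centre [Nonempty D] : ℕ → D := (D.exists_iUnion_chart_source_eq_univ).choose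

variable {D} in
/-- The sources of the chosen covering charts cover `D`. [folklore] -/
private theorem iUnion_source_centre [Nonempty D] : (⋃ k, (D.chart (centre (D := D) k)).source) = univ :=
  (D.exists_iUnion_chart_source_eq_univ).choose_spec

variable {D} in
/-- The pull-back of Lebesgue measure along the `k`-th covering chart, as a measure on `D`
(supported in the source of that chart). [folklore] -/
private def pieceMeasure [Nonempty D] (k : ℕ) : MeasureTheory.Measure D :=
  (Measure.comap (fun y : (D.chart (centre (D := D) k)).source ↦ D.chart (centre (D := D) k) y)
    (volume : MeasureTheory.Measure (ι → ℂ))).map Subtype.val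

variable {D} in
/-- The `k`-th piece measure of a Borel set `A` is the Lebesgue measure of the projection of
`A ∩ (source of the k-th chart)`. [folklore] -/
private theorem pieceMeasure_apply [Nonempty D] (k : ℕ) {A : Set D} (hA : MeasurableSet A) :
    pieceMeasure (D := D) k A = volume (D.proj '' (A ∩ (D.chart (centre (D := D) k)).source)) := by
  rw [pieceMeasure, Measure.map_apply measurable_subtype_coe hA,
    (measurableEmbedding_restrict (D.chart (centre (D := D) k))).comap_apply]
  congr 1
  ext z
  simp only [mem_image, mem_preimage, Subtype.exists, exists_and_right, mem_inter_iff, D.coe_chart]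
  constructor
  · rintro ⟨y, ⟨hy, hyA⟩, rfl⟩
    exact ⟨y, ⟨hyA, hy⟩, rfl⟩
  · rintro ⟨y, ⟨hyA, hy⟩, rfl⟩
    exact ⟨y, ⟨hy, hyA⟩, rfl⟩

/-- **The Lebesgue measure of a Riemann domain**: the Borel measure `vol` on `D` with
`vol A = λ(proj(A))` for every Borel `A` on which `proj` is injective (`vol_eq_volume_image`).
Construction: glue the pull-backs of `λ` along countably many flat charts over the disjoint Borel
decomposition `disjointed` of their sources. [cite: HormanderSCV1973, §4.1 (the measure `dλ`)] -/
def vol : MeasureTheory.Measure D := by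
  classical
  exact if h : Nonempty D then
    Measure.sum fun k : ℕ ↦ (pieceMeasure (D := D) k).restrict
      (disjointed (fun k ↦ (D.chart (@centre ι _ D h k)).source) k)
  else 0

variable {D}

/-- **Characterisation of `vol`**: for a Borel set `A` contained in the source of a local inverse
`e` of `proj`, `vol A = λ(proj(A))`. [cite: HormanderSCV1973, §4.1 (the measure `dλ`)] -/
theorem vol_eq_volume_image {e : OpenPartialHomeomorph D (ι → ℂ)} (he : ⇑e = D.proj) {A : Set D}
    (hA : MeasurableSet A) (hAe : A ⊆ e.source) : D.vol A = volume (D.proj '' A) := by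
  classical
  rcases isEmpty_or_nonempty D with hD | hD
  · have hA0 : A = ∅ := eq_empty_of_isEmpty A
    subst hA0
    simp [vol]
  · rw [vol, dif_pos hD, Measure.sum_apply _ hA]
    set P : ℕ → Set D := disjointed (fun k ↦ (D.chart (centre (D := D) k)).source) with hP
    have hPmeas : ∀ k, MeasurableSet (P k) :=
      MeasurableSet.disjointed fun k ↦ (D.chart (centre (D := D) k)).open_source.measurableSet
    have hPsub : ∀ k, P k ⊆ (D.chart (centre (D := D) k)).source := fun k ↦ disjointed_subset _ k
    have hPunion : (⋃ k, P k) = univ := by rw [hP, iUnion_disjointed, iUnion_source_centre]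
    have hterm : ∀ k, (pieceMeasure (D := D) k).restrict (P k) A = volume (D.proj '' (A ∩ P k)) := by
      intro k
      rw [Measure.restrict_apply hA, pieceMeasure_apply k (hA.inter (hPmeas k))]
      congr 2
      rw [inter_assoc, inter_eq_left.2 (hPsub k)]
    simp_rw [hterm]
    -- the images `proj '' (A ∩ P k)` are disjoint Borel sets with union `proj '' A`
    have hinj : InjOn D.proj A := by rw [← he]; exact e.injOn.mono hAe
    have hdisj : Pairwise (Disjoint on fun k ↦ D.proj '' (A ∩ P k)) := by
      intro j k hjk
      have hd : A ∩ P j ∩ (A ∩ P k) = ∅ := Set.disjoint_iff_inter_eq_empty.1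
        ((disjoint_disjointed _ hjk).mono inter_subset_right inter_subset_right)
      rw [Function.onFun, Set.disjoint_iff_inter_eq_empty,
        ← hinj.image_inter inter_subset_left inter_subset_left, hd, image_empty]
    have hmeas : ∀ k, MeasurableSet (D.proj '' (A ∩ P k)) := fun k ↦
      measurableSet_image he (hA.inter (hPmeas k)) (inter_subset_left.trans hAe)
    have hUnion : D.proj '' A = ⋃ k, D.proj '' (A ∩ P k) := by
      rw [← image_iUnion, ← inter_iUnion, hPunion, inter_univ]
    rw [hUnion, measure_iUnion hdisj hmeas]

end Measure

/-! ### Change of variables along a flat chart -/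

section ChangeOfVariables

variable {D}
variable {G' : Type*} [NormedAddCommGroup G'] [NormedSpace ℝ G']

/-- For a local inverse `e` of `proj`: `proj '' (A ∩ e.source) = e.target ∩ e⁻¹ ⁻¹' A`. [folklore] -/
theorem image_inter_source_eq {e : OpenPartialHomeomorph D (ι → ℂ)} (he : ⇑e = D.proj) (A : Set D) :
    D.proj '' (A ∩ e.source) = e.target ∩ e.symm ⁻¹' A := by
  rw [← he, inter_comm, e.image_source_inter_eq']

/-- **`vol` in a flat chart**: for every local inverse `e` of `proj`, the push-forward of
`λ|e.target` along `e⁻¹` is `vol|e.source`. [cite: HormanderSCV1973, §4.1 (the measure `dλ`)] -/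
theorem map_symm_volume_restrict {e : OpenPartialHomeomorph D (ι → ℂ)} (he : ⇑e = D.proj) :
    (volume.restrict e.target).map e.symm = D.vol.restrict e.source := by
  have hmeas : AEMeasurable e.symm (volume.restrict e.target) :=
    e.continuousOn_symm.aemeasurable e.open_target.measurableSet
  ext A hA
  rw [Measure.map_apply_of_aemeasurable hmeas hA, Measure.restrict_apply' e.open_target.measurableSet,
    Measure.restrict_apply hA,
    vol_eq_volume_image he (hA.inter e.open_source.measurableSet) inter_subset_right,
    image_inter_source_eq he, inter_comm]

omit [NormedSpace ℝ G'] in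
/-- AE-strong measurability transfers from `vol|e.source` to the chart. [folklore] -/
theorem aestronglyMeasurable_comp_symm {e : OpenPartialHomeomorph D (ι → ℂ)} (he : ⇑e = D.proj)
    {f : D → G'} (hf : AEStronglyMeasurable f (D.vol.restrict e.source)) :
    AEStronglyMeasurable (f ∘ e.symm) (volume.restrict e.target) := by
  rw [← map_symm_volume_restrict he] at hf
  exact hf.comp_aemeasurable (e.continuousOn_symm.aemeasurable e.open_target.measurableSet)

/-- **Change of variables along a flat chart**: `∫_{e.source} f d vol = ∫_{e.target} f ∘ e⁻¹ dλ`
for every local inverse `e` of `proj`. [cite: HormanderSCV1973, §4.1 (the measure `dλ`)] -/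
theorem setIntegral_source_eq {e : OpenPartialHomeomorph D (ι → ℂ)} (he : ⇑e = D.proj) {f : D → G'}
    (hf : AEStronglyMeasurable f (D.vol.restrict e.source)) :
    ∫ x in e.source, f x ∂D.vol = ∫ z in e.target, f (e.symm z) ∂volume := by
  have hmeas : AEMeasurable e.symm (volume.restrict e.target) :=
    e.continuousOn_symm.aemeasurable e.open_target.measurableSet
  rw [← map_symm_volume_restrict he] at hf ⊢
  exact MeasureTheory.integral_map hmeas hf

/-- **Change of variables for a chart-supported integrand**: if `f` vanishes off `e.source`, then
`∫_D f d vol = ∫_{e.target} f ∘ e⁻¹ dλ`. [cite: HormanderSCV1973, §4.1 (the measure `dλ`)] -/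
theorem integral_eq_setIntegral_target {e : OpenPartialHomeomorph D (ι → ℂ)} (he : ⇑e = D.proj)
    {f : D → G'} (hf : AEStronglyMeasurable f D.vol) (hsupp : support f ⊆ e.source) :
    ∫ x, f x ∂D.vol = ∫ z in e.target, f (e.symm z) ∂volume := by
  rw [← setIntegral_source_eq he hf.restrict]
  refine (setIntegral_eq_integral_of_forall_compl_eq_zero fun x hx ↦ ?_).symm
  by_contra h
  exact hx (hsupp h)

/-- The same with the right-hand side written as an integral over `ℂ^ι` of the extension by zero.
[folklore] -/
theorem integral_eq_integral_indicator {e : OpenPartialHomeomorph D (ι → ℂ)} (he : ⇑e = D.proj)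
    {f : D → G'} (hf : AEStronglyMeasurable f D.vol) (hsupp : support f ⊆ e.source) :
    ∫ x, f x ∂D.vol = ∫ z, e.target.indicator (f ∘ e.symm) z ∂volume := by
  rw [integral_eq_setIntegral_target he hf hsupp, integral_indicator e.open_target.measurableSet]
  rfl

end ChangeOfVariables

/-! ### Finiteness on compact sets -/

section Compacts

variable {D}

/-- `vol` is finite on compact sets (a compact set is covered by finitely many flat charts, and
`proj` of a compact set has finite Lebesgue measure). [folklore] -/
instance instIsFiniteMeasureOnCompacts : IsFiniteMeasureOnCompacts D.vol := by
  refine ⟨fun K hK ↦ ?_⟩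
  -- a finite subcover of `K` by flat chart sources
  obtain ⟨t, -, htfin, ht⟩ := hK.elim_finite_subcover_image (b := univ)
    (c := fun x : D ↦ (D.chart x).source) (fun x _ ↦ (D.chart x).open_source)
    (fun x hx ↦ mem_biUnion (mem_univ x) (D.mem_chart_source x))
  have hvolK : volume (D.proj '' K) < ⊤ := (hK.image D.isLocalHomeomorph.continuous).measure_lt_top
  have hKmeas : MeasurableSet K := hK.isClosed.measurableSet
  have hsub : K ⊆ ⋃ x ∈ htfin.toFinset, K ∩ (D.chart x).source := by
    intro y hy
    obtain ⟨x, hx, hyx⟩ := mem_iUnion₂.1 (ht hy)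
    exact mem_iUnion₂.2 ⟨x, htfin.mem_toFinset.2 hx, hy, hyx⟩
  calc D.vol K ≤ D.vol (⋃ x ∈ htfin.toFinset, K ∩ (D.chart x).source) := measure_mono hsub
    _ ≤ ∑ x ∈ htfin.toFinset, D.vol (K ∩ (D.chart x).source) := measure_biUnion_finset_le _ _
    _ < ⊤ := by
        refine ENNReal.sum_lt_top.2 fun x _ ↦ ?_
        rw [vol_eq_volume_image (D.coe_chart x) (hKmeas.inter (D.chart x).open_source.measurableSet)
          inter_subset_right]
        exact lt_of_le_of_lt (measure_mono (image_mono inter_subset_left)) hvolK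

/-- `vol` is locally finite. [folklore] -/
instance instIsLocallyFiniteMeasure : IsLocallyFiniteMeasure D.vol :=
  isLocallyFiniteMeasure_of_isFiniteMeasureOnCompacts

/-- Continuous compactly supported functions are `vol`-integrable. [folklore] -/
theorem integrable_of_hasCompactSupport {G' : Type*} [NormedAddCommGroup G'] {f : D → G'}
    (hf : Continuous f) (hfc : HasCompactSupport f) : Integrable f D.vol :=
  hf.integrable_of_hasCompactSupport hfc

end Compacts

/-! ### Integration by parts: `∫ ∂ w d vol = 0` for compactly supported smooth `w` -/

section IBP

variable {D}
variable {G : Type*} [NormedAddCommGroup G] [NormedSpace ℂ G]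

/-- The flat derivative of `w` vanishes off the topological support of `w`. [folklore] -/
theorem fderivF_eq_zero_of_notMem_tsupport {w : D → G} {x : D} (hx : x ∉ tsupport w) :
    fderivF w x = 0 := by
  have h0 : w =ᶠ[𝓝 x] 0 := notMem_tsupport_iff_eventuallyEq.1 hx
  -- the representative vanishes near `proj x`
  have hcont : Tendsto (D.chart x).symm (𝓝 (D.proj x)) (𝓝 x) := by
    have := (D.chart x).continuousAt_symm (D.proj_mem_chart_target x)
    rwa [ContinuousAt, D.chart_symm_proj] at this
  have h1 : (w ∘ (D.chart x).symm) =ᶠ[𝓝 (D.proj x)] fun _ ↦ (0 : G) := hcont.eventually h0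
  rw [fderivF, h1.fderiv_eq]
  exact fderiv_const_apply 0

/-- The support of `x ↦ fderivF w x` is contained in the topological support of `w`. [folklore] -/
theorem support_fderivF_subset (w : D → G) : support (fderivF w) ⊆ tsupport w := fun x hx ↦ by
  by_contra h
  exact hx (fderivF_eq_zero_of_notMem_tsupport h)

/-- The support of `x ↦ D w x (v)` is contained in the topological support of `w`. [folklore] -/
theorem support_fderivF_apply_subset (w : D → G) (v : ι → ℂ) :
    support (fun x ↦ fderivF w x v) ⊆ tsupport w := fun x hx ↦ by
  by_contra h
  refine hx ?_
  show fderivF w x v = 0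
  rw [fderivF_eq_zero_of_notMem_tsupport h]
  rfl

/-- **Transport of a chart-supported smooth function to `ℂ^ι`.** If `g : D → G` is `C^∞` with
compact support inside the source of a local inverse `e` of `proj`, then its extension by zero
`e.target.indicator (g ∘ e⁻¹)` is a `C^∞` function on `ℂ^ι` with compact support contained in
`e.target`, agreeing with `g ∘ e⁻¹` on `e.target`. [folklore] -/
theorem contDiff_indicator_comp_symm {e : OpenPartialHomeomorph D (ι → ℂ)} (he : ⇑e = D.proj)
    {g : D → G} (hg : ContMDiff 𝓘(ℝ, ι → ℂ) 𝓘(ℝ, G) ∞ g) (hgc : HasCompactSupport g)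
    (hge : tsupport g ⊆ e.source) :
    ContDiff ℝ ∞ (e.target.indicator (g ∘ e.symm)) ∧ HasCompactSupport (e.target.indicator (g ∘ e.symm)) ∧
      tsupport (e.target.indicator (g ∘ e.symm)) ⊆ e.target := by
  -- the compact set `K' = e(tsupport g) ⊆ e.target` carries the support
  set K' : Set (ι → ℂ) := e '' tsupport g with hK'
  have hK'c : IsCompact K' := hgc.image_of_continuousOn (e.continuousOn.mono hge)
  have hK'sub : K' ⊆ e.target := by
    rintro _ ⟨y, hy, rfl⟩
    exact e.map_source (hge hy)
  have hsupp : support (e.target.indicator (g ∘ e.symm)) ⊆ K' := by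
    intro z hz
    rw [mem_support, indicator_apply_ne_zero] at hz
    obtain ⟨hzt, hzg⟩ := hz
    refine ⟨e.symm z, subset_tsupport _ hzg, e.right_inv hzt⟩
  have htsupp : tsupport (e.target.indicator (g ∘ e.symm)) ⊆ K' :=
    closure_minimal hsupp hK'c.isClosed
  refine ⟨?_, HasCompactSupport.of_support_subset_isCompact hK'c hsupp, htsupp.trans hK'sub⟩
  -- smoothness: near a point of `e.target` the function is `g ∘ e⁻¹`, elsewhere it is `0` near the point
  rw [contDiff_iff_contDiffAt]
  intro z
  by_cases hz : z ∈ e.target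
  · have heq : e.target.indicator (g ∘ e.symm) =ᶠ[𝓝 z] g ∘ e.symm := by
      filter_upwards [e.open_target.mem_nhds hz] with z' hz'
      exact indicator_of_mem hz' _
    exact ((contDiffOn_comp_symm hg he).contDiffAt (e.open_target.mem_nhds hz)).congr_of_eventuallyEq heq
  · have hzK : z ∉ K' := fun h ↦ hz (hK'sub h)
    have heq : e.target.indicator (g ∘ e.symm) =ᶠ[𝓝 z] fun _ ↦ 0 := by
      filter_upwards [hK'c.isClosed.isOpen_compl.mem_nhds hzK] with z' hz'
      by_contra h
      exact hz' (hsupp h)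
    exact (contDiffAt_const (c := (0 : G))).congr_of_eventuallyEq heq

/-- **Integration by parts for one chart-supported piece**: if `g : D → ℂ` is `C^∞` with compact
support inside the source of a local inverse of `proj`, then `∫_D D g (v) d vol = 0` (transport to
`ℂ^ι` and `∫_{ℂ^ι} D_v F dλ = 0`). [cite: HormanderSCV1973, §4.2 p. 83] -/
theorem integral_fderivF_apply_eq_zero_of_tsupport_subset {e : OpenPartialHomeomorph D (ι → ℂ)}
    (he : ⇑e = D.proj) {g : D → ℂ} (hg : ContMDiff 𝓘(ℝ, ι → ℂ) 𝓘(ℝ, ℂ) ∞ g)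
    (hgc : HasCompactSupport g) (hge : tsupport g ⊆ e.source) (v : ι → ℂ) :
    ∫ x, fderivF g x v ∂D.vol = 0 := by
  obtain ⟨hGs, hGc, -⟩ := contDiff_indicator_comp_symm he hg hgc hge
  -- `∫_D D g (v) = ∫_{ℂ^ι} (extension by zero of (D g (v)) ∘ e⁻¹)`
  have hcont : Continuous fun x ↦ fderivF g x v := (contMDiff_fderivF_apply hg v).continuous
  have h1 : ∫ x, fderivF g x v ∂D.vol =
      ∫ z, e.target.indicator ((fun x ↦ fderivF g x v) ∘ e.symm) z ∂volume :=
    integral_eq_integral_indicator he hcont.aestronglyMeasurable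
      ((support_fderivF_apply_subset g v).trans hge)
  -- the integrand is the directional derivative of the extension by zero
  have h2 : e.target.indicator ((fun x ↦ fderivF g x v) ∘ e.symm) =
      fun z ↦ fderiv ℝ (e.target.indicator (g ∘ e.symm)) z v := by
    funext z
    by_cases hz : z ∈ e.target
    · rw [indicator_of_mem hz, comp_apply, fderivF_comp_symm he hz]
      congr 1
      refine Filter.EventuallyEq.fderiv_eq ?_
      filter_upwards [e.open_target.mem_nhds hz] with z' hz'
      exact (indicator_of_mem hz' _).symm
    · rw [indicator_of_notMem hz]
      -- `z` is off the (closed) topological support of the extension, which lies in `e.target`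
      obtain ⟨-, -, htsupp⟩ := contDiff_indicator_comp_symm he hg hgc hge
      have hz' : z ∉ tsupport (e.target.indicator (g ∘ e.symm)) := fun h ↦ hz (htsupp h)
      rw [(notMem_tsupport_iff_eventuallyEq.1 hz').fderiv_eq]
      simp
  rw [h1, h2]
  exact Literature.Analysis.Pluripotential.integral_dirDeriv_eq_zero hGs hGc v

/-- **Decomposition into chart-supported pieces**: a compactly supported `C^∞` function on `D`
is a finite sum of compactly supported `C^∞` functions each supported in the source of a flat chart
(smooth partition of unity subordinate to the flat charts; only finitely many members meet the
support). [folklore] -/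
theorem exists_eq_finset_sum_chart_supported {w : D → ℂ} (hw : ContMDiff 𝓘(ℝ, ι → ℂ) 𝓘(ℝ, ℂ) ∞ w)
    (hwc : HasCompactSupport w) :
    ∃ (T : Finset D) (g : D → D → ℂ), (∀ i, ContMDiff 𝓘(ℝ, ι → ℂ) 𝓘(ℝ, ℂ) ∞ (g i)) ∧
      (∀ i, HasCompactSupport (g i)) ∧ (∀ i, tsupport (g i) ⊆ (D.chart i).source) ∧
      w = fun x ↦ ∑ i ∈ T, g i x := by
  classical
  -- a smooth partition of unity subordinate to the flat chart sources
  obtain ⟨ρ, hρ⟩ := SmoothPartitionOfUnity.exists_isSubordinate 𝓘(ℝ, ι → ℂ) isClosed_univ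
    (fun x : D ↦ (D.chart x).source) (fun x ↦ (D.chart x).open_source)
    (fun x _ ↦ mem_iUnion.2 ⟨x, D.mem_chart_source x⟩)
  -- only finitely many members meet the support of `w`
  have hfin : {i | (support (ρ i) ∩ tsupport w).Nonempty}.Finite :=
    ρ.locallyFinite.finite_nonempty_inter_compact hwc
  have hgs : ∀ i, ContMDiff 𝓘(ℝ, ι → ℂ) 𝓘(ℝ, ℂ) ∞ (fun x ↦ (ρ i x : ℝ) • w x) := fun i ↦
    (ρ i).contMDiff.smul hw
  have hgc : ∀ i, HasCompactSupport (fun x ↦ (ρ i x : ℝ) • w x) := fun i ↦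
    hwc.smul_left (f := fun x ↦ (ρ i x : ℝ))
  have hge : ∀ i, tsupport (fun x ↦ (ρ i x : ℝ) • w x) ⊆ (D.chart i).source := fun i ↦
    (tsupport_smul_subset_left (fun x ↦ (ρ i x : ℝ)) w).trans (hρ i)
  refine ⟨hfin.toFinset, fun i x ↦ (ρ i x : ℝ) • w x, hgs, hgc, hge, ?_⟩
  funext x
  by_cases hx : w x = 0
  · simp only [hx, smul_zero, Finset.sum_const_zero]
  · have hxK : x ∈ tsupport w := subset_tsupport _ hx
    have h1 : ∑ᶠ i, ρ i x = 1 := ρ.sum_eq_one (mem_univ x)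
    have hsub : (support fun i ↦ ρ i x) ⊆ (hfin.toFinset : Set D) := by
      intro i hi
      rw [Finite.coe_toFinset]
      exact ⟨x, hi, hxK⟩
    rw [finsum_eq_sum_of_support_subset _ hsub] at h1
    rw [← Finset.sum_smul, h1, one_smul]

/-- `fderivF` of a finite sum of `C^∞` functions. [folklore] -/
theorem fderivF_finset_sum_apply {T : Finset D} {g : D → D → ℂ}
    (hg : ∀ i, ContMDiff 𝓘(ℝ, ι → ℂ) 𝓘(ℝ, ℂ) ∞ (g i)) (x : D) (v : ι → ℂ) :
    fderivF (fun y ↦ ∑ i ∈ T, g i y) x v = ∑ i ∈ T, fderivF (g i) x v := by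
  have hcomp : ((fun y ↦ ∑ i ∈ T, g i y) ∘ (D.chart x).symm) =
      fun z ↦ ∑ i ∈ T, (g i ∘ (D.chart x).symm) z := by
    funext z
    simp only [comp_apply]
  rw [fderivF, hcomp, fderiv_fun_sum fun i _ ↦ differentiableAt_comp_symm (hg i x) (by simp)]
  simp only [FunLike.coe_sum, Finset.sum_apply]
  rfl

/-- **Integration by parts on a Riemann domain**: for `w : D → ℂ` of class `C^∞` with compact
support and every direction `v`, `∫_D D w (v) d vol = 0` — by a smooth partition of unity
subordinate to the flat charts, `w` is a finite sum of chart-supported pieces.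
[cite: HormanderSCV1973, §4.2 p. 83] -/
theorem integral_fderivF_apply_eq_zero {w : D → ℂ} (hw : ContMDiff 𝓘(ℝ, ι → ℂ) 𝓘(ℝ, ℂ) ∞ w)
    (hwc : HasCompactSupport w) (v : ι → ℂ) : ∫ x, fderivF w x v ∂D.vol = 0 := by
  obtain ⟨T, g, hgs, hgc, hge, hsum⟩ := exists_eq_finset_sum_chart_supported hw hwc
  have hint : ∀ i ∈ T, Integrable (fun x ↦ fderivF (g i) x v) D.vol := fun i _ ↦
    ((contMDiff_fderivF_apply (hgs i) v).continuous).integrable_of_hasCompactSupport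
      ((hgc i).mono' (support_fderivF_apply_subset (g i) v))
  have hderiv : (fun x ↦ fderivF w x v) = fun x ↦ ∑ i ∈ T, fderivF (g i) x v := by
    funext x
    rw [hsum]
    exact fderivF_finset_sum_apply hgs x v
  rw [hderiv, integral_finsetSum T (f := fun i x ↦ fderivF (g i) x v) hint]
  exact Finset.sum_eq_zero fun i _ ↦
    integral_fderivF_apply_eq_zero_of_tsupport_subset (D.coe_chart i) (hgs i) (hgc i) (hge i) v

/-- `∫_D ∂_v w d vol = 0` for compactly supported `C^∞` `w`. [cite: HormanderSCV1973, §4.2 p. 83] -/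
theorem integral_del_eq_zero {w : D → ℂ} (hw : ContMDiff 𝓘(ℝ, ι → ℂ) 𝓘(ℝ, ℂ) ∞ w)
    (hwc : HasCompactSupport w) (v : ι → ℂ) : ∫ x, del v w x ∂D.vol = 0 := by
  simp only [del_eq_fderivF, smul_eq_mul]
  have h1 := integral_fderivF_apply_eq_zero hw hwc v
  have h2 := integral_fderivF_apply_eq_zero hw hwc (I • v)
  have hi1 : Integrable (fun x ↦ fderivF w x v) D.vol :=
    ((contMDiff_fderivF_apply hw v).continuous).integrable_of_hasCompactSupport
      (hwc.mono' (support_fderivF_apply_subset w v))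
  have hi2 : Integrable (fun x ↦ fderivF w x (I • v)) D.vol :=
    ((contMDiff_fderivF_apply hw (I • v)).continuous).integrable_of_hasCompactSupport
      (hwc.mono' (support_fderivF_apply_subset w (I • v)))
  rw [integral_const_mul, integral_sub hi1 (hi2.const_mul I), integral_const_mul, h1, h2, mul_zero,
    sub_zero, mul_zero]

/-- `∫_D ∂̄_v w d vol = 0` for compactly supported `C^∞` `w`. [cite: HormanderSCV1973, §4.2 p. 83] -/
theorem integral_dbar_eq_zero {w : D → ℂ} (hw : ContMDiff 𝓘(ℝ, ι → ℂ) 𝓘(ℝ, ℂ) ∞ w)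
    (hwc : HasCompactSupport w) (v : ι → ℂ) : ∫ x, dbar v w x ∂D.vol = 0 := by
  simp only [dbar_eq_fderivF, smul_eq_mul]
  have h1 := integral_fderivF_apply_eq_zero hw hwc v
  have h2 := integral_fderivF_apply_eq_zero hw hwc (I • v)
  have hi1 : Integrable (fun x ↦ fderivF w x v) D.vol :=
    ((contMDiff_fderivF_apply hw v).continuous).integrable_of_hasCompactSupport
      (hwc.mono' (support_fderivF_apply_subset w v))
  have hi2 : Integrable (fun x ↦ fderivF w x (I • v)) D.vol :=
    ((contMDiff_fderivF_apply hw (I • v)).continuous).integrable_of_hasCompactSupport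
      (hwc.mono' (support_fderivF_apply_subset w (I • v)))
  rw [integral_const_mul, integral_add hi1 (hi2.const_mul I), integral_const_mul, h1, h2, mul_zero,
    add_zero, mul_zero]

end IBP

end RiemannDomain

end Literature.Analysis.Complex
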